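import Literature.Probability.Percolation.PortCountSq
import HarnessLib

/-!
# The cut-off at excised squares: a mesh-independent port count

Topic `Probability/Percolation`.  Support file (definitions and proofs, no named fact) for step (C)
of the proof of Schramm–Smirnov's Prop. 4.1 (Ann. Probab. 39 (2011), §4).  `PortCountSq.lean`
bounds the owners of the hub contacts of the traced loop by `2 · #landings + #sqSides`, where
`#sqSides` — the number of loop sides facing an excised square — grows like the length of the
square contacts in lattice units.  Here the square contribution is cut down to a quantity that does
not grow with the mesh: a transition out of a square contact (`transition_sq`) happens at a corner
`2y + cornerOff j` where the in-cell is the dry face `faceAt y (j+2)` with an accessible side, the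
out-cell is the square bond `βc y (j+3)` (the site `y + e_{j+3}` is excised), and either (A) `y` is a
hub vertex, or (B) `y` is a non-hub window vertex and the next out-cell is the fresh bond
`βc y (j+2)`, which forces `y + e_{j+3}` to be a CONVEX CORNER of the excised set.  Transitions of
kind (A) at hub vertices of the window are at most two per straight run of square contacts
(`no_three_hubs`: the winding number of the closed walk "square step at the middle hub, non-window
walk, examined open path back" is constant on the accessible region and jumps by one across the
middle square step only), hence at most twice the number of run ends; those at far hub vertices sit
at faces cornered by a far, an excised and a window site.  The resulting owner bound
(`exists_owners_sq_cutoff`) is `max 1 (2 · #landings + 2 · #runEnds + #farSqFaces + #sqCorners)`.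

## References

* O. Schramm, S. Smirnov, *On the scaling limits of planar percolation*, Ann. Probab. 39 (2011)
  1768–1814, arXiv:1101.5820, §4, proof of Prop. 4.1 ("on `¬S` the number of bays is bounded by a
  constant depending only on `s'`, `β`, `β'` and `Q₀`"; the modification `ω̃` near the discs).
  [SchrammSmirnov2011]
-/

noncomputable section

open Set Relation
open Literature.Probability.LatticeModels
open scoped Classical

namespace Literature.Probability.Percolation

namespace CellComplex

namespace TileData

variable {𝒯 : TileData} {d₀ : Site 2 × Fin 4} {SQ : Set (Site 2)}

/-! ### Corners of a face -/

/-- The four corners of the face `faceAt y (j + 2)`: `y`, `y + e_{j+2}`, `y + e_{j+3}` and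
`y + e_{j+2} + e_{j+3}`. [folklore] -/
theorem eq_of_touchesFace_faceAt_add_two {u y : Site 2} {j : Fin 4} (h : TouchesFace u (faceAt y (j + 2))) :
    u = y ∨ u = y + cornerUnit (j + 2) ∨ u = y + cornerUnit (j + 3) ∨ u = y + cornerUnit (j + 2) + cornerUnit (j + 3) := by
  obtain ⟨k, hk⟩ := touchesFace_iff_exists_faceAt.1 h
  -- `faceAt u k = faceAt y (j+2)` gives `u = y - cornerOff (j+2) + cornerOff k`
  have hu : u = y - cornerOff (j + 2) + cornerOff k := by
    simp only [faceAt] at hk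
    rw [hk]; abel
  obtain ⟨t, rfl⟩ := fin4_exists_add j k
  rcases (show t = 0 ∨ t = 1 ∨ t = 2 ∨ t = 3 by fin_cases t <;> simp) with rfl | rfl | rfl | rfl
  · right; right; right
    rw [hu]; ext i; fin_cases i <;> fin_cases j <;> simp [cornerOff, cornerUnit] <;> omega
  · right; right; left
    rw [hu]; ext i; fin_cases i <;> fin_cases j <;> simp [cornerOff, cornerUnit] <;> omega
  · left
    rw [hu]; ext i; fin_cases i <;> fin_cases j <;> simp [cornerOff]
  · right; left
    rw [hu]; ext i; fin_cases i <;> fin_cases j <;> simp [cornerOff, cornerUnit] <;> omega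

/-- Equal bond cells have equal edges. [folklore] -/
theorem dartEdge_eq_of_βc_eq {y y' : Site 2} {m m' : Fin 4} (h : βc y m = βc y' m') : dartEdge y m = dartEdge y' m' :=
  bcell_injOn (dartEdge_mem_edgeSet _ _) (dartEdge_mem_edgeSet _ _) (by rw [bcell_dartEdge, bcell_dartEdge, h])

/-! ### The transition lemma at a square contact -/

section Sq

variable (hSQW : ∀ q ∈ SQ, q ∉ 𝒯.Wv) (hSQO : ∀ q ∈ SQ, q ∉ 𝒯.O)
include hSQW hSQO

/-- **The transition lemma at a square contact.**  If the `i`-th out-cell of the loop is a square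
bond cell and the `(i+1)`-st side is open, then at the corner `vert (i+1) = 2y + cornerOff j` the
in-cell is the dry face `faceAt y (j+2)` (with an accessible side), the out-cell is the square bond
`βc y (j+3)` with `y + e_{j+3}` excised and `y` not excised, and either `y` is a hub vertex, or `y`
is a non-hub window vertex and the fresh bond `βc y (j+2)` is out of the tile domain. [folklore] -/
theorem transition_sq {i : ℕ} (hsq : IsSqCell SQ (𝒯.outCell d₀ i)) (hop : 𝒯.IsOpenSide d₀ (i + 1)) (h₀ : IsBd 𝒯.U d₀) :
    ∃ y j, vert 𝒯.U d₀ (i + 1) = σc y + cornerOff j ∧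
      faceAt (vert 𝒯.U d₀ i) (dirAt 𝒯.U d₀ i) = φc (faceAt y (j + 2)) ∧ 𝒯.outCell d₀ i = βc y (j + 3) ∧
      φc (faceAt y (j + 2)) ∈ 𝒯.U ∧ y + cornerUnit (j + 3) ∈ SQ ∧ y ∉ SQ ∧
      (y ∈ 𝒯.O ∨ (y ∉ 𝒯.O ∧ y ∈ 𝒯.Wv ∧ βc y (j + 2) ∉ 𝒯.U)) := by
  obtain ⟨y, j, hq⟩ := exists_corner_eq (vert 𝒯.U d₀ (i + 1))
  set k := dirAt 𝒯.U d₀ i with hk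
  have hin : faceAt (vert 𝒯.U d₀ i) k = faceAt (vert 𝒯.U d₀ (i + 1)) (k + 1) := by
    rw [vert_succ, ← hk, faceAt_add_unit_succ]
  have hout : 𝒯.outCell d₀ i = faceAt (vert 𝒯.U d₀ (i + 1)) (k + 2) := by
    rw [TileData.outCell, vert_succ, ← hk, faceAt_add_unit_add_two]
  have hinU : faceAt (vert 𝒯.U d₀ i) k ∈ 𝒯.U := (isBd_bdOrbit h₀ i).1
  have hY : 𝒯.outCell d₀ (i + 1) ∉ 𝒯.U := (isBd_bdOrbit h₀ (i + 1)).2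
  rw [hq] at hin hout
  obtain ⟨r, hr⟩ := fin4_exists_add j (k + 1)
  rw [hr] at hin
  rw [show k + 2 = k + 1 + 1 from (fin4_add_one_add_one k).symm, hr] at hout
  rcases (show r = 0 ∨ r = 1 ∨ r = 2 ∨ r = 3 by fin_cases r <;> simp) with rfl | rfl | rfl | rfl
  · -- in-cell `σ y`: no open cell at this corner
    rw [add_zero, faceAt_corner_self] at hin
    exfalso
    rw [hin] at hinU
    have := not_open_of_σc_mem hinU (dirAt 𝒯.U d₀ (i + 1) + 3) (by rwa [← hq])
    rw [← hq] at this
    exact this hop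
  · -- out-cell a face cell: not a square bond
    rw [fin4_add_one_add_one, faceAt_corner_add_two] at hout
    exact absurd (hout ▸ hsq) (not_isSqCell_φc _)
  · -- the genuine case
    rw [faceAt_corner_add_two] at hin
    rw [fin4_add_two_add_one, faceAt_corner_add_three] at hout
    have hφU : φc (faceAt y (j + 2)) ∈ 𝒯.U := hin ▸ hinU
    -- the next out-cell, at the same corner
    obtain ⟨r', hr'⟩ := fin4_exists_add j (dirAt 𝒯.U d₀ (i + 1) + 3)
    have hout' : 𝒯.outCell d₀ (i + 1) = faceAt (σc y + cornerOff j) (j + r') := by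
      rw [TileData.outCell, hq, hr']
    have hcase : y ∈ 𝒯.O ∨ (y ∉ 𝒯.O ∧ y ∈ 𝒯.Wv ∧ βc y (j + 2) ∉ 𝒯.U) := by
      rcases (show r' = 0 ∨ r' = 1 ∨ r' = 2 ∨ r' = 3 by fin_cases r' <;> simp) with rfl | rfl | rfl | rfl
      · rw [add_zero, faceAt_corner_self] at hout'
        rcases hop with hh | hp
        · rcases (show 𝒯.IsHubCell (σc y) from hout' ▸ hh) with ⟨v, hvO, hv⟩ | ⟨y', m', -, hc⟩
          · exact Or.inl (σc_injective hv ▸ hvO)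
          · exact absurd hc (σc_ne_βc y y' m')
        · obtain ⟨y', m', hc, -⟩ := (show 𝒯.IsPocketCell (σc y) from hout' ▸ hp)
          exact absurd hc (σc_ne_βc y y' m')
      · rw [faceAt_corner_add_one] at hout'
        rcases hop with hh | hp
        · rcases (show 𝒯.IsHubCell (βc y (j + 2)) from hout' ▸ hh) with ⟨v, -, hv⟩ | ⟨y', m', hhub, hc⟩
          · exact absurd hv.symm (σc_ne_βc v y (j + 2))
          · have he := dartEdge_eq_of_βc_eq hc
            exact Or.inl (𝒯.hub_O _ hhub y (he ▸ mem_dartEdge_iff.2 (Or.inl rfl)))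
        · obtain ⟨y', m', hc, -, -, -, hy', hym'⟩ := (show 𝒯.IsPocketCell (βc y (j + 2)) from hout' ▸ hp)
          have he := dartEdge_eq_of_βc_eq hc
          have hyW : y ∈ 𝒯.Wv := by
            have : y ∈ dartEdge y' m' := he ▸ mem_dartEdge_iff.2 (Or.inl rfl)
            rcases mem_dartEdge_iff.1 this with rfl | rfl
            exacts [hy', hym']
          by_cases hyO : y ∈ 𝒯.O
          · exact Or.inl hyO
          · exact Or.inr ⟨hyO, hyW, hout' ▸ hY⟩
      · rw [faceAt_corner_add_two] at hout'
        exact absurd hφU (hout' ▸ hY)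
      · rw [faceAt_corner_add_three] at hout'
        rcases hop with hh | hp
        · exact absurd (hout' ▸ hh) (not_isHubCell_of_isSqCell hSQO (hout ▸ hsq))
        · exact absurd (hout' ▸ hp) (not_isPocketCell_of_isSqCell hSQW (hout ▸ hsq))
    have hySQ : y ∉ SQ := by
      rcases hcase with hyO | ⟨-, hyW, -⟩
      · exact fun h => hSQO y h hyO
      · exact fun h => hSQW y h hyW
    have hqSQ : y + cornerUnit (j + 3) ∈ SQ := by
      obtain ⟨y', m', hc, hq'⟩ := hout ▸ hsq
      have he := dartEdge_eq_of_βc_eq hc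
      have hmem : ∀ w, (w ∈ SQ) → w ∈ dartEdge y' m' → w = y + cornerUnit (j + 3) := by
        intro w hw hwe
        rw [← he] at hwe
        rcases mem_dartEdge_iff.1 hwe with rfl | rfl
        · exact absurd hw hySQ
        · rfl
      rcases hq' with h | h
      · rw [← hmem y' h (mem_dartEdge_iff.2 (Or.inl rfl))]; exact h
      · rw [← hmem _ h (mem_dartEdge_iff.2 (Or.inr rfl))]; exact h
    exact ⟨y, j, hq, hin, hout, hφU, hqSQ, hySQ, hcase⟩
  · -- out-cell `σ y`: not a square bond
    rw [fin4_add_three_add_one, faceAt_corner_self] at hout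
    exact absurd (hout ▸ hsq) (not_isSqCell_σc _)

omit hSQO in
/-- In case (B) of the transition lemma the excised site is a **convex corner** of the excised set:
its neighbours `y` and `y + e_{j+2} + e_{j+3}` are not excised. [folklore] -/
theorem convexCorner_of_transition_sq {y : Site 2} {j : Fin 4} (hφU : φc (faceAt y (j + 2)) ∈ 𝒯.U)
    (hqSQ : y + cornerUnit (j + 3) ∈ SQ) (hβ : βc y (j + 2) ∉ 𝒯.U) :
    y + cornerUnit (j + 2) + cornerUnit (j + 3) ∉ SQ := by
  intro hwSQ
  obtain ⟨-, e, he, hfe⟩ := (φc_mem_U_iff 𝒯).1 hφU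
  -- the accessible side has window endpoints, corners of the face: it is `{y, y + e_{j+2}}`
  have heE := 𝒯.acc_edge e he
  have hwin := 𝒯.acc_window e he
  have hcorner : ∀ u ∈ e, u = y ∨ u = y + cornerUnit (j + 2) := by
    intro u hu
    rcases eq_of_touchesFace_faceAt_add_two (touchesFace_of_isFaceOf heE hfe hu) with h | h | h | h
    · exact Or.inl h
    · exact Or.inr h
    · exact absurd hqSQ (h ▸ fun h' => hSQW u h' (hwin u hu))
    · exact absurd hwSQ (h ▸ fun h' => hSQW u h' (hwin u hu))
  have heq : e = dartEdge y (j + 2) := by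
    obtain ⟨a, b, hab, rfl⟩ : ∃ a b, a ≠ b ∧ e = s(a, b) := by
      induction e using Sym2.ind with
      | h a b => exact ⟨a, b, ((SimpleGraph.mem_edgeSet _).1 heE).ne, rfl⟩
    rcases hcorner a (Sym2.mem_mk_left _ _) with rfl | rfl <;>
      rcases hcorner b (Sym2.mem_mk_right _ _) with rfl | rfl
    · exact absurd rfl hab
    · rfl
    · rw [Sym2.eq_swap]; rfl
    · exact absurd rfl hab
  exact hβ ((βc_mem_U_iff 𝒯).2 (heq ▸ he))

end Sq


/-! ### Winding numbers of a closed walk whose vertices are hubs or carry no accessible edge -/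

section Walk

variable {n : ℕ} {w : ℕ → Site 2} {hper : ∀ j, w (j + n) = w j} {hadj : ∀ j, (zdGraph 2).Adj (w j) (w (j + 1))}
  {Ch : Set (Sym2 (Site 2))}

/-- (K1') The vertices of the walk are hub vertices or carry no accessible edge. [folklore] -/
def WalkVerts' (𝒯 : TileData) (w : ℕ → Site 2) : Prop := ∀ j, w j ∈ 𝒯.O ∨ ∀ e ∈ 𝒯.acc, w j ∉ e

/-- `notMem_walk_of_acc'` (notMem walk of acc'). [folklore] -/
private theorem notMem_walk_of_acc' (hV : WalkVerts' 𝒯 w) {u : Site 2} (hu : u ∉ 𝒯.O) {e : Sym2 (Site 2)}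
    (he : e ∈ 𝒯.acc) (hue : u ∈ e) (j : ℕ) : w j ≠ u := by
  intro h
  rcases hV j with h' | h'
  · exact hu (h ▸ h')
  · exact h' e he (h ▸ hue)

/-- **The winding number is constant on the faces of accessible edges** (under (K1')). [folklore] -/
private theorem W_isFaceOf_acc_eq' (hV : WalkVerts' 𝒯 w) (hS : WalkSteps 𝒯 Ch w) (hCh : ∀ e ∈ Ch, e ∉ 𝒯.acc)
    {e₁ e₂ : Sym2 (Site 2)} (he₁ : e₁ ∈ 𝒯.acc) (he₂ : e₂ ∈ 𝒯.acc) {F₁ F₂ : Site 2} (hF₁ : IsFaceOf F₁ e₁)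
    (hF₂ : IsFaceOf F₂ e₂) :
    (ClosedWalk.ofSites w hper hadj).W (toZ2 F₁) = (ClosedWalk.ofSites w hper hadj).W (toZ2 F₂) := by
  set κ := ClosedWalk.ofSites w hper hadj with hκ
  have key : ∀ e, ReflTransGen (fun a b => a ∈ 𝒯.acc ∧ b ∈ 𝒯.acc ∧ ∃ u, u ∈ a ∧ u ∈ b ∧ u ∉ 𝒯.O) e₁ e →
      e ∈ 𝒯.acc ∧ ∀ F, IsFaceOf F e → κ.W (toZ2 F) = κ.W (toZ2 F₁) := by
    intro e he
    induction he with
    | refl => exact ⟨he₁, fun F hF => W_isFaceOf_acc_eq_of_same (hper := hper) (hadj := hadj) hS hCh he₁ hF hF₁⟩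
    | @tail a b _ hab ih =>
      obtain ⟨ha, hb, u, hua, hub, huO⟩ := hab
      refine ⟨hb, fun F hF => ?_⟩
      obtain ⟨Fa, hFa⟩ : ∃ Fa, IsFaceOf Fa a := by
        obtain ⟨p, q, -, hpq⟩ := exists_dualEdge_eq_mk (𝒯.acc_edge a ha)
        exact ⟨p, isFaceOf_left_of_dualEdge_eq hpq⟩
      have hu : ∀ j, κ.v j ≠ toZ2 u := ClosedWalk.v_ofSites_ne (notMem_walk_of_acc' hV huO ha hua)
      rw [← ih.2 Fa hFa]
      exact W_eq_of_touchesFace_of_notMem κ hu (touchesFace_of_isFaceOf (𝒯.acc_edge b hb) hF hub)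
        (touchesFace_of_isFaceOf (𝒯.acc_edge a ha) hFa hua)
  exact ((key e₂ (𝒯.acc_conn e₁ he₁ e₂ he₂)).2 F₂ hF₂).symm

end Walk

/-! ### No three hub transitions on one run of square contacts -/

section Three

variable (hSQW : ∀ q ∈ SQ, q ∉ 𝒯.Wv) (hSQO : ∀ q ∈ SQ, q ∉ 𝒯.O)
  (hWconn : ∀ u u', u ∉ 𝒯.Wv → u' ∉ 𝒯.Wv →
    ReflTransGen (fun a b => a ∉ 𝒯.Wv ∧ b ∉ 𝒯.Wv ∧ (zdGraph 2).Adj a b) u u')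
include hSQW hSQO hWconn

omit hSQW hSQO hWconn in
/-- Positions of a run. [folklore] -/
theorem run_succ (y₀ : Site 2) (d : Fin 4) (t : ℕ) :
    y₀ + ((t + 1 : ℕ) : ℤ) • cornerUnit d = y₀ + (t : ℤ) • cornerUnit d + cornerUnit d := by
  rw [Nat.cast_succ, add_zsmul, one_zsmul, add_assoc]

omit hSQW hSQO hWconn in
/-- Positions of a run are distinct. [folklore] -/
theorem run_injective (y₀ : Site 2) (d : Fin 4) {t t' : ℕ}
    (h : y₀ + (t : ℤ) • cornerUnit d = y₀ + (t' : ℤ) • cornerUnit d) : t = t' := by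
  have h1 : ((t : ℤ) - t') • cornerUnit d = 0 := by rw [sub_zsmul]; exact sub_eq_zero.2 (add_left_cancel h)
  rcases smul_eq_zero.1 h1 with h2 | h2
  · exact_mod_cast sub_eq_zero.1 h2
  · exfalso
    have := congrArg (fun v : Site 2 => |v 0| + |v 1|) h2
    fin_cases d <;> simp [cornerUnit] at this

/-- **No three hub transitions on one run.**  Along a run of square contacts
`y_t = y₀ + t e_d ∈ Wv`, `y_t + e_{d+1} ∈ SQ` (`t ≤ T`), there are no three positions
`t₁ < t₂ < t₃` at hub vertices each of whose square edges has a face with an accessible side.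
[cite: SchrammSmirnov2011, §4, proof of Prop. 4.1 ("on ¬S the number of bays is bounded")] -/
theorem no_three_hubs (d : Fin 4) (y₀ : Site 2) (T : ℕ)
    (hrun : ∀ t : ℕ, t ≤ T → y₀ + (t : ℤ) • cornerUnit d ∈ 𝒯.Wv ∧ y₀ + (t : ℤ) • cornerUnit d + cornerUnit (d + 1) ∈ SQ)
    {t₁ t₂ t₃ : ℕ} (h12 : t₁ < t₂) (h23 : t₂ < t₃) (h3 : t₃ ≤ T)
    (hO : ∀ t, (t = t₁ ∨ t = t₂ ∨ t = t₃) → y₀ + (t : ℤ) • cornerUnit d ∈ 𝒯.O)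
    (hface : ∀ t, (t = t₁ ∨ t = t₃) → ∃ F, IsFaceOf F (dartEdge (y₀ + (t : ℤ) • cornerUnit d) (d + 1)) ∧
      ∃ e ∈ 𝒯.acc, IsFaceOf F e) : False := by
  -- notation
  set y : ℕ → Site 2 := fun t => y₀ + (t : ℤ) • cornerUnit d with hy
  set q : ℕ → Site 2 := fun t => y t + cornerUnit (d + 1) with hq
  have hysucc : ∀ t, y (t + 1) = y t + cornerUnit d := fun t => run_succ y₀ d t
  have hyW : ∀ t ≤ T, y t ∈ 𝒯.Wv := fun t ht => (hrun t ht).1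
  have hqSQ : ∀ t ≤ T, q t ∈ SQ := fun t ht => (hrun t ht).2
  set c := y t₂ with hc
  set c' := q t₂ with hc'
  have hcO : c ∈ 𝒯.O := hO t₂ (Or.inr (Or.inl rfl))
  have hcW : c ∈ 𝒯.Wv := hyW t₂ (by omega)
  have hc'SQ : c' ∈ SQ := hqSQ t₂ (by omega)
  have hc'W : c' ∉ 𝒯.Wv := hSQW _ hc'SQ
  have hc'O : c' ∉ 𝒯.O := hSQO _ hc'SQ
  have hcc' : c ≠ c' := fun h => hc'W (h ▸ hcW)
  have hadj_cc' : (zdGraph 2).Adj c c' := (SimpleGraph.mem_edgeSet (G := zdGraph 2)).1 (dartEdge_mem_edgeSet c (d + 1))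
  -- the steps of the closing walk: examined open edges, or steps outside the window
  set StepR : Site 2 → Site 2 → Prop := fun a b => (zdGraph 2).Adj a b ∧ (s(a, b) ∈ 𝒯.hubE ∨ (a ∉ 𝒯.Wv ∧ b ∉ 𝒯.Wv))
    with hStepR
  have hubStep_rev : ∀ {a b}, ReflTransGen (fun a b => s(a, b) ∈ 𝒯.hubE) a b → ReflTransGen StepR b a := by
    intro a b h
    induction h with
    | refl => exact ReflTransGen.refl
    | @tail x z _ hxz ih =>
      refine ReflTransGen.head ⟨?_, Or.inl ?_⟩ ih
      · exact ((SimpleGraph.mem_edgeSet (G := zdGraph 2)).1 (𝒯.hub_edge _ hxz)).symm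
      · rwa [Sym2.eq_swap]
  obtain ⟨u, huW, hP⟩ := 𝒯.esc_O c hcO
  have farStep' : ∀ {a b}, ReflTransGen (fun a b => a ∉ 𝒯.Wv ∧ b ∉ 𝒯.Wv ∧ (zdGraph 2).Adj a b) a b →
      ReflTransGen StepR a b := by
    intro a b h
    induction h with
    | refl => exact ReflTransGen.refl
    | tail _ hst ih => exact ih.tail ⟨hst.2.2, Or.inr ⟨hst.1, hst.2.1⟩⟩
  have farStep : ReflTransGen StepR c' u := farStep' (hWconn c' u hc'W huW)
  have hR : ReflTransGen StepR c' c := farStep.trans (hubStep_rev hP)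
  -- the closed walk `c, c', …, c`
  obtain ⟨l, hchain, hlast⟩ := List.exists_isChain_cons_of_relationReflTransGen hR
  set M : List (Site 2) := c' :: l with hM
  set n : ℕ := M.length with hn
  have hn1 : 1 ≤ n := by rw [hn, hM, List.length_cons]; omega
  have hn2 : 2 ≤ n := by
    rw [hn, hM, List.length_cons]
    rcases l with _ | ⟨x, l'⟩
    · exfalso
      simp only [List.getLast_singleton] at hlast
      exact hcc' hlast.symm
    · simp
  set L : List (Site 2) := c :: M with hL
  set wf : ℕ → Site 2 := fun j => L.getD (j % n) c with hwf
  have hL0 : L.getD 0 c = c := rfl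
  have hLsucc : ∀ i, L.getD (i + 1) c = M.getD i c := fun i => rfl
  have hMget : ∀ i (hi : i < n), M.getD i c = M[i]'(by rw [hn] at hi; exact hi) := fun i hi => List.getD_eq_getElem _ _ _
  have hMlast : M.getD (n - 1) c = c := by
    rw [hMget (n - 1) (by omega), ← hlast, List.getLast_eq_getElem]
  have hwf0 : wf 0 = c := by simp only [hwf, Nat.zero_mod]; rfl
  have hwf1 : wf 1 = c' := by
    simp only [hwf, Nat.one_mod_eq_one.2 (by omega : n ≠ 1)]; rfl
  have step_cases : ∀ j, (j % n = 0 ∧ wf j = c ∧ wf (j + 1) = c') ∨ (j % n ≠ 0 ∧ StepR (wf j) (wf (j + 1))) := by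
    intro j
    have hi : j % n < n := Nat.mod_lt _ (by omega)
    by_cases hlt : j % n + 1 < n
    · have hmod : (j + 1) % n = j % n + 1 := by
        rw [Nat.add_mod, Nat.one_mod_eq_one.2 (by omega : n ≠ 1), Nat.mod_eq_of_lt hlt]
      rcases h0 : j % n with _ | i'
      · left
        refine ⟨rfl, ?_, ?_⟩
        · simp only [hwf, h0]; rfl
        · simp only [hwf, hmod, h0]; rfl
      · right
        refine ⟨by omega, ?_⟩
        rw [h0] at hlt
        have e1 : wf j = M.getD i' c := by simp only [hwf, h0, hLsucc]
        have e2 : wf (j + 1) = M.getD (i' + 1) c := by simp only [hwf, hmod, h0, hLsucc]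
        rw [e1, e2, hMget i' (by omega), hMget (i' + 1) (by omega)]
        exact hchain.getElem i' (by rw [← hn]; omega)
    · right
      have heq : j % n = n - 1 := by omega
      have hmod : (j + 1) % n = 0 := by
        rw [Nat.add_mod, heq, Nat.one_mod_eq_one.2 (by omega : n ≠ 1), Nat.sub_add_cancel hn1, Nat.mod_self]
      refine ⟨by omega, ?_⟩
      obtain ⟨i', hi'⟩ : ∃ i', n - 1 = i' + 1 := ⟨n - 2, by omega⟩
      have e1 : wf j = M.getD i' c := by simp only [hwf, heq, hi', hLsucc]
      have e2 : wf (j + 1) = c := by simp only [hwf, hmod, hL0]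
      rw [e1, e2, hMget i' (by omega)]
      have hst := hchain.getElem i' (by rw [← hn]; omega)
      have hlastel : M[i' + 1]'(by rw [← hn]; omega) = c := by rw [← hMget (i' + 1) (by omega), ← hi', hMlast]
      rwa [hlastel] at hst
  have hadj : ∀ j, (zdGraph 2).Adj (wf j) (wf (j + 1)) := by
    intro j
    rcases step_cases j with ⟨-, h1, h2⟩ | ⟨-, h⟩
    · rw [h1, h2]; exact hadj_cc'
    · exact h.1
  have hper : ∀ j, wf (j + n) = wf j := fun j => by simp only [hwf, Nat.add_mod_right]
  set κ := ClosedWalk.ofSites wf hper hadj with hκ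
  -- the vertices of `M` are hub vertices or outside the window
  have hMO : ∀ x ∈ M, x ∈ 𝒯.O ∨ x ∉ 𝒯.Wv := by
    refine hchain.induction (fun x => x ∈ 𝒯.O ∨ x ∉ 𝒯.Wv) M (fun x z hxz _ => ?_) (fun _ => Or.inr hc'W)
    rcases hxz.2 with h | h
    · exact Or.inl (𝒯.hub_O _ h z (Sym2.mem_mk_right x z))
    · exact Or.inr h.2
  have hV : WalkVerts' 𝒯 wf := by
    intro j
    have key : wf j ∈ 𝒯.O ∨ wf j ∉ 𝒯.Wv := by
      simp only [hwf]
      rcases h0 : j % n with _ | i'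
      · exact Or.inl hcO
      · rw [hLsucc, hMget i' (by have := Nat.mod_lt j (by omega : 0 < n); omega)]
        exact hMO _ (List.getElem_mem _)
    rcases key with h | h
    · exact Or.inl h
    · exact Or.inr fun e he hje => h (𝒯.acc_window e he _ hje)
  set Ch : Set (Sym2 (Site 2)) := {e | ∃ a b, e = s(a, b) ∧ a ∉ 𝒯.Wv ∧ b ∉ 𝒯.Wv} ∪ {dartEdge c (d + 1)} with hCh_def
  have hS : WalkSteps 𝒯 Ch wf := by
    intro j
    rcases step_cases j with ⟨-, h1, h2⟩ | ⟨-, h⟩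
    · right; left; rw [h1, h2]; exact Or.inr rfl
    · rcases h.2 with h' | h'
      · exact Or.inl h'
      · exact Or.inr (Or.inl (Or.inl ⟨_, _, rfl, h'.1, h'.2⟩))
  have hCh : ∀ e ∈ Ch, e ∉ 𝒯.acc := by
    rintro e (⟨a, b, rfl, ha, -⟩ | he) hacc
    · exact ha (𝒯.acc_window _ hacc a (Sym2.mem_mk_left _ _))
    · rw [Set.mem_singleton_iff] at he
      subst he
      exact hc'W (𝒯.acc_window _ hacc c' (mem_dartEdge_iff.2 (Or.inr rfl)))
  -- no `StepR` step along a square edge of the run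
  have notStepR : ∀ t ≤ T, ¬ StepR (y t) (q t) ∧ ¬ StepR (q t) (y t) := by
    intro t ht
    constructor
    · rintro ⟨-, h | h⟩
      · exact hSQO _ (hqSQ t ht) (𝒯.hub_O _ h _ (Sym2.mem_mk_right _ _))
      · exact h.1 (hyW t ht)
    · rintro ⟨-, h | h⟩
      · exact hSQO _ (hqSQ t ht) (𝒯.hub_O _ h _ (Sym2.mem_mk_left _ _))
      · exact h.2 (hyW t ht)
  -- traversal counts of the square edges of the run
  have hcnt : κ.cnt (toZ2 c) (toZ2 c') = 1 := by
    rw [ClosedWalk.cnt, Finset.sum_eq_single_of_mem 0 (Finset.mem_range.2 (by omega))]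
    · rw [indZ_of_pos]
      show toZ2 (wf 0) = toZ2 c ∧ toZ2 (wf 1) = toZ2 c'
      rw [hwf0, hwf1]; exact ⟨rfl, rfl⟩
    · intro j hj hj0
      rw [indZ_of_neg]
      rintro ⟨h1, h2⟩
      have h1' : wf j = c := toZ2_injective h1
      have h2' : wf (j + 1) = c' := toZ2_injective h2
      have hjn : j < n := Finset.mem_range.1 hj
      rcases step_cases j with ⟨hj0', -, -⟩ | ⟨-, h⟩
      · exact hj0 (by rwa [Nat.mod_eq_of_lt hjn] at hj0')
      · rw [h1', h2'] at h; exact (notStepR t₂ (by omega)).1 h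
  have hcnt0 : ∀ t ≤ T, t ≠ t₂ → κ.cnt (toZ2 (y t)) (toZ2 (q t)) = 0 := by
    intro t ht htne
    refine ClosedWalk.cnt_ofSites_eq_zero (x := y t) (y := q t) fun j h => ?_
    rcases step_cases j with ⟨-, h1', -⟩ | ⟨-, h'⟩
    · exact htne (run_injective y₀ d (h.1.symm.trans h1'))
    · rw [h.1, h.2] at h'; exact (notStepR t ht).1 h'
  have hcnt0' : ∀ t ≤ T, κ.cnt (toZ2 (q t)) (toZ2 (y t)) = 0 := by
    intro t ht
    refine ClosedWalk.cnt_ofSites_eq_zero (x := q t) (y := y t) fun j h => ?_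
    rcases step_cases j with ⟨-, h1', -⟩ | ⟨-, h'⟩
    · exact hSQW _ (hqSQ t ht) (h.1.symm.trans h1' ▸ hcW)
    · rw [h.1, h.2] at h'; exact (notStepR t ht).2 h'
  -- the faces along the run: `Φ t = faceAt (y t) (d+1)`, and `Φ (t+1)` is the right face of the
  -- `t`-th square edge
  set Φ : ℕ → Site 2 := fun t => faceAt (y t) (d + 1) with hΦ
  have hd4 : d + 1 + 3 = d := by fin_cases d <;> rfl
  have hΦsucc : ∀ t, Φ (t + 1) = faceAt (y t) (d + 1 + 3) := by
    intro t
    simp only [hΦ]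
    rw [hysucc, hd4, faceAt_add_unit_succ]
  have hjump : ∀ t ≤ T, κ.W (toZ2 (Φ t)) - κ.W (toZ2 (Φ (t + 1))) =
      κ.cnt (toZ2 (y t)) (toZ2 (q t)) - κ.cnt (toZ2 (q t)) (toZ2 (y t)) := by
    intro t _
    rw [hΦsucc]
    exact κ.W_left_sub_W_right (y t) (d + 1)
  have hW : ∀ t ≤ T + 1, κ.W (toZ2 (Φ t)) = κ.W (toZ2 (Φ 0)) - (if t₂ < t then 1 else 0) := by
    intro t ht
    induction t with
    | zero => simp
    | succ t ih =>
      have ih' := ih (by omega)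
      have hj := hjump t (by omega)
      by_cases htt : t = t₂
      · subst htt
        rw [if_neg (lt_irrefl _)] at ih'
        rw [hcnt, hcnt0' t (by omega)] at hj
        rw [if_pos (Nat.lt_succ_self _)]
        linarith
      · rw [hcnt0 t (by omega) htt, hcnt0' t (by omega)] at hj
        have : (if t₂ < t + 1 then (1 : ℤ) else 0) = if t₂ < t then 1 else 0 := by
          by_cases h : t₂ < t
          · rw [if_pos h, if_pos (by omega)]
          · rw [if_neg h, if_neg (by omega)]
        rw [this]
        linarith
  -- the hub faces have the winding number of the accessible region, equal at `t₁` and `t₃`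
  obtain ⟨F₁, hF₁, e₁, he₁, hF₁e⟩ := hface t₁ (Or.inl rfl)
  obtain ⟨F₃, hF₃, e₃, he₃, hF₃e⟩ := hface t₃ (Or.inr rfl)
  have hWeq : κ.W (toZ2 F₁) = κ.W (toZ2 F₃) :=
    W_isFaceOf_acc_eq' (hper := hper) (hadj := hadj) hV hS hCh he₁ he₃ hF₁e hF₃e
  have hF₁W : κ.W (toZ2 F₁) = κ.W (toZ2 (Φ 0)) := by
    rcases isFaceOf_dartEdge_iff.1 hF₁ with h | h
    · rw [h, show faceAt (y t₁) (d + 1) = Φ t₁ from rfl, hW t₁ (by omega), if_neg (by omega)]; simp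
    · rw [h, ← hΦsucc, hW (t₁ + 1) (by omega), if_neg (by omega)]; simp
  have hF₃W : κ.W (toZ2 F₃) = κ.W (toZ2 (Φ 0)) - 1 := by
    rcases isFaceOf_dartEdge_iff.1 hF₃ with h | h
    · rw [h, show faceAt (y t₃) (d + 1) = Φ t₃ from rfl, hW t₃ (by omega), if_pos (by omega)]
    · rw [h, ← hΦsucc, hW (t₃ + 1) (by omega), if_pos (by omega)]
  rw [hF₁W, hF₃W] at hWeq
  linarith

end Three


/-! ### Runs and their ends -/

section Runs

variable (hWfin : 𝒯.Wv.Finite)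
include hWfin

/-- A run in a fixed direction leaves the (finite) window. [folklore] -/
theorem exists_not_valid (y : Site 2) (d : Fin 4) :
    ∃ t : ℕ, ¬ (y + ((t + 1 : ℕ) : ℤ) • cornerUnit d ∈ 𝒯.Wv ∧ y + ((t + 1 : ℕ) : ℤ) • cornerUnit d + cornerUnit (d + 1) ∈ SQ) := by
  by_contra h
  push Not at h
  have hinj : Function.Injective fun t : ℕ => y + ((t + 1 : ℕ) : ℤ) • cornerUnit d := by
    intro t t' htt'
    have := run_injective y d htt'
    omega
  exact (Set.infinite_range_of_injective hinj) (hWfin.subset (by rintro _ ⟨t, rfl⟩; exact (h t).1))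

variable (SQ) in
/-- **The end position of the run** from `y` in direction `d` (square contacts on the side `d + 1`). [folklore] -/
def endPos (y : Site 2) (d : Fin 4) : ℕ := Nat.find (exists_not_valid (SQ := SQ) hWfin y d)

/-- The run is valid up to its end position. [folklore] -/
theorem valid_of_le_endPos {y : Site 2} {d : Fin 4} (h0 : y ∈ 𝒯.Wv ∧ y + cornerUnit (d + 1) ∈ SQ) {t : ℕ}
    (ht : t ≤ endPos SQ hWfin y d) :
    y + (t : ℤ) • cornerUnit d ∈ 𝒯.Wv ∧ y + (t : ℤ) • cornerUnit d + cornerUnit (d + 1) ∈ SQ := by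
  rcases t with _ | t
  · simpa using h0
  · have := Nat.find_min (exists_not_valid (SQ := SQ) hWfin y d) (m := t) (by unfold endPos at ht; omega)
    push Not at this
    exact this

/-- Just after the end position the run fails. [folklore] -/
theorem not_valid_endPos_succ (y : Site 2) (d : Fin 4) :
    ¬ (y + ((endPos SQ hWfin y d + 1 : ℕ) : ℤ) • cornerUnit d ∈ 𝒯.Wv ∧
      y + ((endPos SQ hWfin y d + 1 : ℕ) : ℤ) • cornerUnit d + cornerUnit (d + 1) ∈ SQ) :=
  Nat.find_spec (exists_not_valid (SQ := SQ) hWfin y d)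

variable (𝒯 SQ) in
omit hWfin in
/-- **Run ends**: window sites `E` with `E + e_{d+1}` excised at which the run in direction `d`
stops. [folklore] -/
def runEnds (hWfin : 𝒯.Wv.Finite) : Finset (Site 2 × Fin 4) :=
  (hWfin.toFinset ×ˢ Finset.univ).filter fun p =>
    p.1 + cornerUnit (p.2 + 1) ∈ SQ ∧ ¬ (p.1 + cornerUnit p.2 ∈ 𝒯.Wv ∧ p.1 + cornerUnit p.2 + cornerUnit (p.2 + 1) ∈ SQ)

/-- The end site of a run is a run end. [folklore] -/
theorem endSite_mem_runEnds {y : Site 2} {d : Fin 4} (h0 : y ∈ 𝒯.Wv ∧ y + cornerUnit (d + 1) ∈ SQ) :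
    (y + (endPos SQ hWfin y d : ℤ) • cornerUnit d, d) ∈ 𝒯.runEnds SQ hWfin := by
  have hv := valid_of_le_endPos hWfin h0 le_rfl
  have hnv := not_valid_endPos_succ (SQ := SQ) hWfin y d
  rw [run_succ] at hnv
  refine Finset.mem_filter.2 ⟨Finset.mem_product.2 ⟨hWfin.mem_toFinset.2 hv.1, Finset.mem_univ _⟩, hv.2, hnv⟩

end Runs

/-! ### Counting the square transitions -/

section Count

variable (hSQW : ∀ q ∈ SQ, q ∉ 𝒯.Wv) (hSQO : ∀ q ∈ SQ, q ∉ 𝒯.O)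
  (hWconn : ∀ u u', u ∉ 𝒯.Wv → u' ∉ 𝒯.Wv →
    ReflTransGen (fun a b => a ∉ 𝒯.Wv ∧ b ∉ 𝒯.Wv ∧ (zdGraph 2).Adj a b) u u')
  (hWfin : 𝒯.Wv.Finite) (hSQfin : SQ.Finite) (h₀ : IsBd 𝒯.U d₀)

variable (𝒯 d₀ SQ) in
/-- **Square transitions**: indices in a period whose out-cell is a square bond cell followed by an
open side. [folklore] -/
def sqTrans (h₀ : IsBd 𝒯.U d₀) : Finset ℕ :=
  (Finset.range (period h₀)).filter fun i => IsSqCell SQ (𝒯.outCell d₀ i) ∧ 𝒯.IsOpenSide d₀ (i + 1)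

variable (SQ) in
/-- **Convex corners of the excised set** (indexed by the quadrant `j` of the transition lemma: the
site `q` with `q + e_{j+1}` and `q + e_{j+2}` not excised). [folklore] -/
def sqCorners (hSQfin : SQ.Finite) : Finset (Site 2 × Fin 4) :=
  (hSQfin.toFinset ×ˢ Finset.univ).filter fun p => p.1 + cornerUnit (p.2 + 1) ∉ SQ ∧ p.1 + cornerUnit (p.2 + 2) ∉ SQ

variable (𝒯 SQ) in
/-- **Faces at a far, an excised and a window corner**: pairs `(y, j)` with `y` outside the window
and not excised, `y + e_{j+3}` excised and `y + e_{j+2}` in the window. [folklore] -/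
def farSqFaces (hWfin : 𝒯.Wv.Finite) : Finset (Site 2 × Fin 4) :=
  ((hWfin.toFinset ×ˢ Finset.univ).image fun p : Site 2 × Fin 4 => (p.1 - cornerUnit (p.2 + 2), p.2)).filter
    fun p => p.1 ∉ 𝒯.Wv ∧ p.1 + cornerUnit (p.2 + 3) ∈ SQ ∧ p.1 + cornerUnit (p.2 + 2) ∈ 𝒯.Wv

/-- The data of a square transition (from `transition_sq`). [folklore] -/
def SqData (𝒯 : TileData) (d₀ : Site 2 × Fin 4) (SQ : Set (Site 2)) (i : ℕ) (y : Site 2) (j : Fin 4) : Prop :=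
  vert 𝒯.U d₀ (i + 1) = σc y + cornerOff j ∧
    faceAt (vert 𝒯.U d₀ i) (dirAt 𝒯.U d₀ i) = φc (faceAt y (j + 2)) ∧ 𝒯.outCell d₀ i = βc y (j + 3) ∧
    φc (faceAt y (j + 2)) ∈ 𝒯.U ∧ y + cornerUnit (j + 3) ∈ SQ ∧ y ∉ SQ ∧
    (y ∈ 𝒯.O ∨ (y ∉ 𝒯.O ∧ y ∈ 𝒯.Wv ∧ βc y (j + 2) ∉ 𝒯.U))

include hSQW hSQO h₀ in
/-- `exists_sqData` (exists sqData). [folklore] -/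
theorem exists_sqData {i : ℕ} (hi : i ∈ 𝒯.sqTrans d₀ SQ h₀) : ∃ p : Site 2 × Fin 4, SqData 𝒯 d₀ SQ i p.1 p.2 := by
  obtain ⟨-, hsq, hop⟩ := Finset.mem_filter.1 hi
  obtain ⟨y, j, h⟩ := transition_sq hSQW hSQO hsq hop h₀
  exact ⟨(y, j), h⟩

/-- **The face of a square transition has the winding data**: it is a face of the square edge and has
an accessible side. [folklore] -/
theorem face_of_sqData {i : ℕ} {y : Site 2} {j : Fin 4} (h : SqData 𝒯 d₀ SQ i y j) :
    ∃ F, IsFaceOf F (dartEdge y (j + 2 + 1)) ∧ ∃ e ∈ 𝒯.acc, IsFaceOf F e := by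
  obtain ⟨-, -, -, hφU, -⟩ := h
  obtain ⟨-, e, he, hfe⟩ := (φc_mem_U_iff 𝒯).1 hφU
  refine ⟨faceAt y (j + 2), ?_, e, he, hfe⟩
  rw [show j + 2 + 1 = j + 3 from by rw [add_assoc]; rfl]
  exact isFaceOf_dartEdge_iff.2 (Or.inr (by rw [show j + 3 + 3 = j + 2 from by fin_cases j <;> rfl]))

include h₀ in
/-- The transition index is determined by the data (the traced loop visits each dart once a period).
[folklore] -/
theorem sqData_injOn {i i' : ℕ} (hi : i ∈ 𝒯.sqTrans d₀ SQ h₀) (hi' : i' ∈ 𝒯.sqTrans d₀ SQ h₀) {y : Site 2} {j : Fin 4}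
    (h : SqData 𝒯 d₀ SQ i y j) (h' : SqData 𝒯 d₀ SQ i' y j) : i = i' := by
  obtain ⟨-, hin, hout, -⟩ := h
  obtain ⟨-, hin', hout', -⟩ := h'
  apply bdOrbit_injOn h₀ (Finset.mem_range.1 (Finset.mem_filter.1 hi).1) (Finset.mem_range.1 (Finset.mem_filter.1 hi').1)
  have h1 : faceAt (vert 𝒯.U d₀ i) (dirAt 𝒯.U d₀ i) = faceAt (vert 𝒯.U d₀ i') (dirAt 𝒯.U d₀ i') := by rw [hin, hin']
  have h2 : 𝒯.outCell d₀ i = 𝒯.outCell d₀ i' := by rw [hout, hout']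
  simp only [TileData.outCell] at h2
  obtain ⟨e1, e2⟩ := dart_eq_of_faceAt_eq h1 h2
  exact Prod.ext e1 e2

/-- Three distinct naturals can be listed increasingly. [folklore] -/
theorem exists_lt_lt_of_three {P : ℕ → Prop} {a b c : ℕ} (hab : a ≠ b) (hac : a ≠ c) (hbc : b ≠ c)
    (ha : P a) (hb : P b) (hc : P c) : ∃ t₁ t₂ t₃, t₁ < t₂ ∧ t₂ < t₃ ∧ P t₁ ∧ P t₂ ∧ P t₃ := by
  rcases Nat.lt_or_gt_of_ne hab with h1 | h1 <;> rcases Nat.lt_or_gt_of_ne hbc with h2 | h2 <;>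
    rcases Nat.lt_or_gt_of_ne hac with h3 | h3
  · exact ⟨a, b, c, h1, h2, ha, hb, hc⟩
  · omega
  · exact ⟨a, c, b, h3, h2, ha, hc, hb⟩
  · exact ⟨c, a, b, h3, h1, hc, ha, hb⟩
  · exact ⟨b, a, c, h1, h3, hb, ha, hc⟩
  · exact ⟨b, c, a, h2, h3, hb, hc, ha⟩
  · omega
  · exact ⟨c, b, a, h2, h1, hc, hb, ha⟩

include hSQW hSQO hWconn hWfin hSQfin h₀ in
/-- **The square transitions are few, independently of the mesh.** [cite: SchrammSmirnov2011, §4, proof of Prop. 4.1 ("on ¬S the number of bays is bounded")] -/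
theorem card_sqTrans_le : (𝒯.sqTrans d₀ SQ h₀).card ≤
    2 * (𝒯.runEnds SQ hWfin).card + (𝒯.farSqFaces SQ hWfin).card + (sqCorners SQ hSQfin).card := by
  classical
  set S := 𝒯.sqTrans d₀ SQ h₀ with hS
  -- the data function
  set g : ℕ → Site 2 × Fin 4 := fun i => if h : i ∈ S then Classical.choose (exists_sqData hSQW hSQO h₀ h) else (0, 0)
    with hg
  have hgspec : ∀ i ∈ S, SqData 𝒯 d₀ SQ i (g i).1 (g i).2 := by
    intro i hi
    simp only [hg, dif_pos hi]
    exact Classical.choose_spec (exists_sqData hSQW hSQO h₀ hi)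
  have hginj : Set.InjOn g ↑S := by
    intro i hi i' hi' hii'
    have h1 := hgspec i hi
    have h2 := hgspec i' hi'
    rw [hii'] at h1
    exact (sqData_injOn h₀ hi' hi h2 h1).symm
  -- the three kinds
  set A1 := S.filter fun i => (g i).1 ∈ 𝒯.O ∧ (g i).1 ∈ 𝒯.Wv with hA1
  set A2 := S.filter fun i => (g i).1 ∈ 𝒯.O ∧ (g i).1 ∉ 𝒯.Wv with hA2
  set B := S.filter fun i => (g i).1 ∉ 𝒯.O with hB
  have hsplit : S.card = A1.card + A2.card + B.card := by
    have e1 := Finset.card_filter_add_card_filter_not (s := S) (fun i => (g i).1 ∈ 𝒯.O)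
    have e2 := Finset.card_filter_add_card_filter_not (s := S.filter fun i => (g i).1 ∈ 𝒯.O) (fun i => (g i).1 ∈ 𝒯.Wv)
    rw [Finset.filter_filter, Finset.filter_filter] at e2
    rw [hA1, hA2, hB, ← e1, ← e2]
  -- (B): convex corners
  have hBle : B.card ≤ (sqCorners SQ hSQfin).card := by
    refine Finset.card_le_card_of_injOn (fun i => ((g i).1 + cornerUnit ((g i).2 + 3), (g i).2)) (fun i hi => ?_) ?_
    · obtain ⟨hiS, hyO⟩ := Finset.mem_filter.1 hi
      obtain ⟨-, -, -, hφU, hqSQ, -, hcase⟩ := hgspec i hiS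
      obtain ⟨-, -, hβ⟩ := hcase.resolve_left hyO
      have hw := convexCorner_of_transition_sq hSQW hφU hqSQ hβ
      refine Finset.mem_coe.2 (Finset.mem_filter.2 ⟨Finset.mem_product.2 ⟨hSQfin.mem_toFinset.2 hqSQ, Finset.mem_univ _⟩, ?_, ?_⟩)
      · have : (g i).1 + cornerUnit ((g i).2 + 3) + cornerUnit ((g i).2 + 1) = (g i).1 := by
          rw [show (g i).2 + 3 = (g i).2 + 1 + 2 from by rw [add_assoc]; rfl, cornerUnit_add_two, add_assoc,
            neg_add_cancel, add_zero]
        simp only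
        rw [this]
        exact (hgspec i hiS).2.2.2.2.2.1
      · simp only
        rwa [add_right_comm] at hw
    · intro i hi i' hi' h
      simp only [Prod.mk.injEq] at h
      obtain ⟨h1, h2⟩ := h
      refine hginj (Finset.mem_filter.1 hi).1 (Finset.mem_filter.1 hi').1 (Prod.ext ?_ h2)
      rw [h2] at h1
      exact add_right_cancel h1
  -- (A2): faces at far–square–window corners
  have hA2le : A2.card ≤ (𝒯.farSqFaces SQ hWfin).card := by
    refine Finset.card_le_card_of_injOn g (fun i hi => ?_) fun i hi i' hi' h => hginj (Finset.mem_filter.1 hi).1 (Finset.mem_filter.1 hi').1 h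
    obtain ⟨hiS, hyO, hyW⟩ := Finset.mem_filter.1 hi
    obtain ⟨-, -, -, hφU, hqSQ, hySQ, -⟩ := hgspec i hiS
    -- the accessible side of the face has window endpoints: `v` and `w`
    obtain ⟨-, e, he, hfe⟩ := (φc_mem_U_iff 𝒯).1 hφU
    have heE := 𝒯.acc_edge e he
    have hwin := 𝒯.acc_window e he
    have hvW : (g i).1 + cornerUnit ((g i).2 + 2) ∈ 𝒯.Wv := by
      obtain ⟨a, b, hab, rfl⟩ : ∃ a b, a ≠ b ∧ e = s(a, b) := by
        induction e using Sym2.ind with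
        | h a b => exact ⟨a, b, ((SimpleGraph.mem_edgeSet _).1 heE).ne, rfl⟩
      have hc : ∀ u ∈ s(a, b), u = (g i).1 + cornerUnit ((g i).2 + 2) ∨ u = (g i).1 + cornerUnit ((g i).2 + 2) + cornerUnit ((g i).2 + 3) := by
        intro u hu
        rcases eq_of_touchesFace_faceAt_add_two (touchesFace_of_isFaceOf heE hfe hu) with h | h | h | h
        · exact absurd (hwin u hu) (h ▸ hyW)
        · exact Or.inl h
        · exact absurd (hwin u hu) (h ▸ hSQW _ hqSQ)
        · exact Or.inr h
      rcases hc a (Sym2.mem_mk_left _ _) with ha | ha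
      · exact ha ▸ hwin a (Sym2.mem_mk_left _ _)
      · rcases hc b (Sym2.mem_mk_right _ _) with hb | hb
        · exact hb ▸ hwin b (Sym2.mem_mk_right _ _)
        · exact absurd (ha.trans hb.symm) hab
    refine Finset.mem_coe.2 (Finset.mem_filter.2 ⟨Finset.mem_image.2 ⟨((g i).1 + cornerUnit ((g i).2 + 2), (g i).2),
      Finset.mem_product.2 ⟨hWfin.mem_toFinset.2 hvW, Finset.mem_univ _⟩, ?_⟩, hyW, hqSQ, hvW⟩)
    simp
  -- (A1): at most two per run end
  set φ : ℕ → Site 2 × Fin 4 := fun i => ((g i).1 + (endPos SQ hWfin (g i).1 ((g i).2 + 2) : ℤ) • cornerUnit ((g i).2 + 2), (g i).2 + 2)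
    with hφ
  have hφmem : ∀ i ∈ A1, φ i ∈ 𝒯.runEnds SQ hWfin := by
    intro i hi
    obtain ⟨hiS, -, hyW⟩ := Finset.mem_filter.1 hi
    obtain ⟨-, -, -, -, hqSQ, -⟩ := hgspec i hiS
    have := endSite_mem_runEnds (SQ := SQ) hWfin (y := (g i).1) (d := (g i).2 + 2) ⟨hyW, by rwa [show (g i).2 + 2 + 1 = (g i).2 + 3 from by rw [add_assoc]; rfl]⟩
    exact this
  have hfib : ∀ b ∈ A1.image φ, (A1.filter fun i => φ i = b).card ≤ 2 := by
    intro b _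
    by_contra hlt
    push Not at hlt
    obtain ⟨i₁, hi₁, i₂, hi₂, i₃, hi₃, h12, h13, h23⟩ := Finset.two_lt_card.1 hlt
    obtain ⟨hi₁A, hφ₁⟩ := Finset.mem_filter.1 hi₁
    obtain ⟨hi₂A, hφ₂⟩ := Finset.mem_filter.1 hi₂
    obtain ⟨hi₃A, hφ₃⟩ := Finset.mem_filter.1 hi₃
    -- common direction and end
    set d := ((g i₁).2 + 2) with hd
    set E := (φ i₁).1 with hE
    have hdir : ∀ {i}, i ∈ A1 → φ i = b → (g i).2 + 2 = d ∧ (g i).2 = (g i₁).2 ∧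
        (g i).1 + (endPos SQ hWfin (g i).1 d : ℤ) • cornerUnit d = E := by
      intro i hi hφi
      have h := hφi.trans hφ₁.symm
      simp only [hφ, Prod.mk.injEq] at h
      have hj : (g i).2 = (g i₁).2 := add_right_cancel h.2
      refine ⟨by rw [hj], hj, ?_⟩
      rw [hd, ← hj]; exact h.1
    -- positions from the farthest hub
    have key : ∀ {i}, i ∈ A1 → φ i = b → ∃ s : ℕ, (g i).1 + (s : ℤ) • cornerUnit d = E ∧ (g i).2 = (g i₁).2 ∧
        (∀ t ≤ s, (g i).1 + (t : ℤ) • cornerUnit d ∈ 𝒯.Wv ∧ (g i).1 + (t : ℤ) • cornerUnit d + cornerUnit (d + 1) ∈ SQ) ∧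
        (g i).1 ∈ 𝒯.O ∧ ∃ F, IsFaceOf F (dartEdge (g i).1 (d + 1)) ∧ ∃ e ∈ 𝒯.acc, IsFaceOf F e := by
      intro i hi hφi
      obtain ⟨hdi, hj, hEi⟩ := hdir hi hφi
      obtain ⟨hiS, hyO, hyW⟩ := Finset.mem_filter.1 hi
      obtain ⟨-, -, -, -, hqSQ, -⟩ := hgspec i hiS
      have h0 : (g i).1 ∈ 𝒯.Wv ∧ (g i).1 + cornerUnit (d + 1) ∈ SQ :=
        ⟨hyW, by rw [← hdi, show (g i).2 + 2 + 1 = (g i).2 + 3 from by rw [add_assoc]; rfl]; exact hqSQ⟩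
      refine ⟨endPos SQ hWfin (g i).1 d, hEi, hj, fun t ht => valid_of_le_endPos hWfin h0 ht, hyO, ?_⟩
      rw [← hdi]
      exact face_of_sqData (hgspec i hiS)
    obtain ⟨s₁, hs₁, hj₁, hrun₁, hO₁, hF₁⟩ := key hi₁A hφ₁
    obtain ⟨s₂, hs₂, hj₂, hrun₂, hO₂, hF₂⟩ := key hi₂A hφ₂
    obtain ⟨s₃, hs₃, hj₃, hrun₃, hO₃, hF₃⟩ := key hi₃A hφ₃
    -- distinct hubs, distinct distances to the end
    have hy : ∀ {i i'}, i ∈ A1 → i' ∈ A1 → i ≠ i' → (g i).2 = (g i').2 → (g i).1 ≠ (g i').1 := by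
      intro i i' hi hi' hne hj heq
      exact hne (hginj (Finset.mem_filter.1 hi).1 (Finset.mem_filter.1 hi').1 (Prod.ext heq hj))
    have hsne : ∀ {i i' : ℕ} {s s' : ℕ}, (g i).1 ≠ (g i').1 → (g i).1 + (s : ℤ) • cornerUnit d = E →
        (g i').1 + (s' : ℤ) • cornerUnit d = E → s ≠ s' := by
      intro i i' s s' hne hs hs' hss'
      subst hss'
      exact hne (add_right_cancel (hs.trans hs'.symm))
    have h12' := hsne (hy hi₁A hi₂A h12 (hj₁.trans hj₂.symm)) hs₁ hs₂
    have h13' := hsne (hy hi₁A hi₃A h13 (hj₁.trans hj₃.symm)) hs₁ hs₃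
    have h23' := hsne (hy hi₂A hi₃A h23 (hj₂.trans hj₃.symm)) hs₂ hs₃
    -- base point: the hub farthest from the end
    set Smax := max s₁ (max s₂ s₃) with hSmax
    set y₀ : Site 2 := E - (Smax : ℤ) • cornerUnit d with hy₀
    have hpos : ∀ {i : ℕ} {s : ℕ}, (g i).1 + (s : ℤ) • cornerUnit d = E → s ≤ Smax →
        (g i).1 = y₀ + ((Smax - s : ℕ) : ℤ) • cornerUnit d := by
      intro i s hs hle
      rw [hy₀, ← hs, Nat.cast_sub hle, sub_zsmul]
      abel
    -- the run from `y₀` up to `Smax` is the run of the farthest hub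
    have hrun : ∀ t : ℕ, t ≤ Smax → y₀ + (t : ℤ) • cornerUnit d ∈ 𝒯.Wv ∧ y₀ + (t : ℤ) • cornerUnit d + cornerUnit (d + 1) ∈ SQ := by
      have aux : ∀ {i : ℕ} {s : ℕ}, (g i).1 + (s : ℤ) • cornerUnit d = E → s = Smax →
          (∀ t ≤ s, (g i).1 + (t : ℤ) • cornerUnit d ∈ 𝒯.Wv ∧ (g i).1 + (t : ℤ) • cornerUnit d + cornerUnit (d + 1) ∈ SQ) →
          ∀ t : ℕ, t ≤ Smax → y₀ + (t : ℤ) • cornerUnit d ∈ 𝒯.Wv ∧ y₀ + (t : ℤ) • cornerUnit d + cornerUnit (d + 1) ∈ SQ := by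
        intro i s hs hsS hr t ht
        have hgi : (g i).1 = y₀ := by have := hpos hs hsS.le; rw [hsS, Nat.sub_self] at this; simpa using this
        rw [← hgi]
        exact hr t (by omega)
      rcases (show s₁ = Smax ∨ s₂ = Smax ∨ s₃ = Smax by omega) with h | h | h
      · exact aux hs₁ h hrun₁
      · exact aux hs₂ h hrun₂
      · exact aux hs₃ h hrun₃
    -- the three positions
    have hP : ∀ {i : ℕ} {s : ℕ}, (g i).1 + (s : ℤ) • cornerUnit d = E → s ≤ Smax → (g i).1 ∈ 𝒯.O →
        (∃ F, IsFaceOf F (dartEdge (g i).1 (d + 1)) ∧ ∃ e ∈ 𝒯.acc, IsFaceOf F e) →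
        (Smax - s : ℕ) ≤ Smax ∧ y₀ + ((Smax - s : ℕ) : ℤ) • cornerUnit d ∈ 𝒯.O ∧
          ∃ F, IsFaceOf F (dartEdge (y₀ + ((Smax - s : ℕ) : ℤ) • cornerUnit d) (d + 1)) ∧ ∃ e ∈ 𝒯.acc, IsFaceOf F e := by
      intro i s hs hle hO hF
      rw [← hpos hs hle]
      exact ⟨Nat.sub_le _ _, hO, hF⟩
    obtain ⟨t₁, t₂, t₃, h12t, h23t, ⟨-, hO1, hF1⟩, ⟨-, hO2, -⟩, ⟨ht₃, hO3, hF3⟩⟩ :=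
      exists_lt_lt_of_three (P := fun t => t ≤ Smax ∧ y₀ + (t : ℤ) • cornerUnit d ∈ 𝒯.O ∧
          ∃ F, IsFaceOf F (dartEdge (y₀ + (t : ℤ) • cornerUnit d) (d + 1)) ∧ ∃ e ∈ 𝒯.acc, IsFaceOf F e)
        (a := Smax - s₁) (b := Smax - s₂) (c := Smax - s₃) (by omega) (by omega) (by omega)
        (hP hs₁ (by omega) hO₁ hF₁) (hP hs₂ (by omega) hO₂ hF₂) (hP hs₃ (by omega) hO₃ hF₃)
    exact no_three_hubs hSQW hSQO hWconn d y₀ Smax hrun h12t h23t ht₃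
      (fun t ht => by rcases ht with rfl | rfl | rfl; exacts [hO1, hO2, hO3])
      (fun t ht => by rcases ht with rfl | rfl; exacts [hF1, hF3])
  have hA1le : A1.card ≤ 2 * (𝒯.runEnds SQ hWfin).card :=
    (Finset.card_le_mul_card_image A1 2 hfib).trans
      (Nat.mul_le_mul_left 2 (Finset.card_le_card (Finset.image_subset_iff.2 hφmem)))
  rw [hsplit]
  omega

end Count


/-! ### The owner bound with the cut-off -/

section Owners

variable (hSQW : ∀ q ∈ SQ, q ∉ 𝒯.Wv) (hSQO : ∀ q ∈ SQ, q ∉ 𝒯.O)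
  (hWconn : ∀ u u', u ∉ 𝒯.Wv → u' ∉ 𝒯.Wv →
    ReflTransGen (fun a b => a ∉ 𝒯.Wv ∧ b ∉ 𝒯.Wv ∧ (zdGraph 2).Adj a b) u u')
  (hWfin : 𝒯.Wv.Finite) (hSQfin : SQ.Finite)
  (hT : 𝒯.Terminal) (hfarO : ∀ u, u ∉ 𝒯.Wv → u ∈ 𝒯.O ∨ u ∈ SQ)
  (hX : ∀ e ∈ (zdGraph 2).edgeSet, (∃ v ∈ e, v ∈ 𝒯.Wv) → (∃ u ∈ e, u ∉ 𝒯.Wv) →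
    e ∈ 𝒯.hubE ∨ e ∈ 𝒯.clE ∨ ∃ q ∈ e, q ∈ SQ)
  (h₀ : IsBd 𝒯.U d₀) (hdisj : ∀ e ∈ 𝒯.hubE, e ∉ 𝒯.clE)
  (hfar : ∀ c c' u₁ u₂ : Site 2, c ∈ 𝒯.O → c' ∈ 𝒯.O → (∃ f, TouchesFace c f ∧ TouchesFace c' f) →
    u₁ ∉ 𝒯.Wv → u₂ ∉ 𝒯.Wv → ReflTransGen (fun a b => s(a, b) ∈ 𝒯.hubE) c u₁ →
    ReflTransGen (fun a b => s(a, b) ∈ 𝒯.hubE) c' u₂ → ReflTransGen (FarAdj 𝒯) u₂ u₁)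

include hSQW hSQO hWconn hWfin hSQfin h₀ in
/-- **Transitions are landings or square transitions**, the latter cut off. [folklore] -/
theorem card_transitions'_le_cutoff : (𝒯.transitions' d₀ SQ h₀).card ≤ 2 * (𝒯.landings).card +
    (2 * (𝒯.runEnds SQ hWfin).card + (𝒯.farSqFaces SQ hWfin).card + (sqCorners SQ hSQfin).card) := by
  classical
  have hsub : 𝒯.transitions' d₀ SQ h₀ ⊆ 𝒯.transitions d₀ h₀ ∪ 𝒯.sqTrans d₀ SQ h₀ := by
    intro i hi
    obtain ⟨hiP, hcl, hop⟩ := Finset.mem_filter.1 hi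
    rcases hcl with hcl | hsq
    · exact Finset.mem_union_left _ (Finset.mem_filter.2 ⟨hiP, hcl, hop⟩)
    · exact Finset.mem_union_right _ (Finset.mem_filter.2 ⟨hiP, hsq, hop⟩)
  calc (𝒯.transitions' d₀ SQ h₀).card ≤ (𝒯.transitions d₀ h₀ ∪ 𝒯.sqTrans d₀ SQ h₀).card := Finset.card_le_card hsub
    _ ≤ (𝒯.transitions d₀ h₀).card + (𝒯.sqTrans d₀ SQ h₀).card := Finset.card_union_le _ _
    _ ≤ _ := by
        have h1 := card_transitions_le (𝒯 := 𝒯) h₀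
        have h2 := card_sqTrans_le hSQW hSQO hWconn hWfin hSQfin h₀
        omega

include hSQW hSQO hWconn hWfin hSQfin hT hfarO hX h₀ hdisj hfar in
/-- **The owners of the hub contacts are few, independently of the mesh (with excised squares).**
There is a set `R` of at most `max 1 (2 · #landings + 2 · #runEnds + #farSqFaces + #sqCorners)` hub
vertices such that every vertex attached to a hub contact of the loop is joined by examined open
edges to a vertex of `R`.
[cite: SchrammSmirnov2011, §4, proof of Prop. 4.1 ("on ¬S the number of bays is bounded by a constant depending only on s′, β, β′ and Q₀")] -/
theorem exists_owners_sq_cutoff : ∃ R : Finset (Site 2),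
    (∀ i, 𝒯.hubContact d₀ i → ∀ v ∈ 𝒯.att (𝒯.outCell d₀ i), ∃ r ∈ R, 𝒯.HubConn v r) ∧
    R.card ≤ max 1 (2 * (𝒯.landings).card +
      (2 * (𝒯.runEnds SQ hWfin).card + (𝒯.farSqFaces SQ hWfin).card + (sqCorners SQ hSQfin).card)) := by
  suffices hmain : ∃ R : Finset (Site 2), R.card ≤ max 1 (2 * (𝒯.landings).card +
      (2 * (𝒯.runEnds SQ hWfin).card + (𝒯.farSqFaces SQ hWfin).card + (sqCorners SQ hSQfin).card)) ∧
      ∀ i, 𝒯.hubContact d₀ i → ∀ v ∈ 𝒯.att (𝒯.outCell d₀ i), ∃ r ∈ R, 𝒯.HubConn v r by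
    obtain ⟨R, h1, h2⟩ := hmain; exact ⟨R, h2, h1⟩
  classical
  have hP0 : 0 < period h₀ := period_pos h₀
  have hout_per : ∀ i q, 𝒯.outCell d₀ (i + q * (period h₀)) = 𝒯.outCell d₀ i := outCell_add_mul_period h₀
  have hhub_per : ∀ i q, 𝒯.hubContact d₀ (i + q * (period h₀)) ↔ 𝒯.hubContact d₀ i := fun i q => by
    simp only [TileData.hubContact, hout_per]
  have hopen_per : ∀ i q, 𝒯.IsOpenSide d₀ (i + q * (period h₀)) ↔ 𝒯.IsOpenSide d₀ i := fun i q => by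
    simp only [IsOpenSide, TileData.hubContact, hout_per]
  have hcl_per : ∀ i q, 𝒯.IsClosedCell' SQ (𝒯.outCell d₀ (i + q * (period h₀))) ↔ 𝒯.IsClosedCell' SQ (𝒯.outCell d₀ i) :=
    fun i q => by rw [hout_per]
  by_cases hall : ∀ i, i < (period h₀) → 𝒯.IsOpenSide d₀ i
  · have hopen : ∀ i, 𝒯.IsOpenSide d₀ i := by
      intro i
      have := hall (i % (period h₀)) (Nat.mod_lt _ hP0)
      rwa [← hopen_per (i % (period h₀)) (i / (period h₀)), Nat.mod_add_div'] at this
    by_cases hex : ∃ i, 𝒯.hubContact d₀ i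
    · obtain ⟨i₁, hi₁⟩ := hex
      obtain ⟨w, hw⟩ := 𝒯.att_nonempty hi₁
      refine ⟨{w}, by simp, fun i hi v hv => ⟨w, Finset.mem_singleton_self _, ?_⟩⟩
      rcases le_total i i₁ with h | h
      · exact hubConn_of_open_stretch' h₀ hT hfar h (fun l _ _ => hopen l) hi hi₁ hv hw
      · exact (hubConn_of_open_stretch' h₀ hT hfar h (fun l _ _ => hopen l) hi₁ hi hw hv).symm
    · push Not at hex
      exact ⟨∅, by simp, fun i hi => absurd hi (hex i)⟩
  · push Not at hall
    obtain ⟨i₁, hi₁P, hi₁⟩ := hall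
    have hcl₁ : 𝒯.IsClosedCell' SQ (𝒯.outCell d₀ i₁) :=
      (isOpenSide_or_isClosedCell' hT hfarO hX h₀ i₁).resolve_left hi₁
    let good : ℕ → Prop := fun t => ∃ n, t < n ∧ 𝒯.hubContact d₀ n ∧ ∀ j, t < j → j ≤ n → 𝒯.IsOpenSide d₀ j
    let rep : ℕ → Site 2 := fun t =>
      if h : good t then (𝒯.att_nonempty (Nat.find_spec h).2.1).choose else 0
    refine ⟨(𝒯.transitions' d₀ SQ h₀).image rep, ?_, ?_⟩
    · exact (Finset.card_image_le.trans (card_transitions'_le_cutoff hSQW hSQO hWconn hWfin hSQfin h₀)).trans (le_max_right _ _)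
    · intro i hi v hv
      obtain ⟨r, k, hrP, hik⟩ : ∃ r k, r < period h₀ ∧ i = r + k * period h₀ :=
        ⟨i % period h₀, i / period h₀, Nat.mod_lt _ hP0, (Nat.mod_add_div' i _).symm⟩
      obtain ⟨n₀, hn₀⟩ : ∃ n₀, n₀ = r + 1 * period h₀ := ⟨_, rfl⟩
      have hi' : 𝒯.hubContact d₀ n₀ := by rw [hn₀, hhub_per, ← hhub_per r k, ← hik]; exact hi
      have hv' : v ∈ 𝒯.att (𝒯.outCell d₀ n₀) := by rw [hn₀, hout_per, ← hout_per r k, ← hik]; exact hv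
      have hexc : ∃ c, c < n₀ ∧ n₀ ≤ c + period h₀ ∧ 𝒯.IsClosedCell' SQ (𝒯.outCell d₀ c) := by
        by_cases hlt : r ≤ i₁
        · exact ⟨i₁, by omega, by omega, hcl₁⟩
        · refine ⟨i₁ + 1 * period h₀, by omega, by omega, ?_⟩
          rw [hcl_per]; exact hcl₁
      set c := Nat.findGreatest (fun c => 𝒯.IsClosedCell' SQ (𝒯.outCell d₀ c)) (n₀ - 1) with hc
      obtain ⟨c₁, hc₁lt, hc₁le, hc₁cl⟩ := hexc
      have hcle : c ≤ n₀ - 1 := Nat.findGreatest_le _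
      have hc₁c : c₁ ≤ c := Nat.le_findGreatest (by omega) hc₁cl
      have hccl : 𝒯.IsClosedCell' SQ (𝒯.outCell d₀ c) :=
        Nat.findGreatest_spec (P := fun c => 𝒯.IsClosedCell' SQ (𝒯.outCell d₀ c)) (by omega) hc₁cl
      have hopen_after : ∀ j, c < j → j ≤ n₀ → 𝒯.IsOpenSide d₀ j := by
        intro j hcj hjn
        rcases (isOpenSide_or_isClosedCell' hT hfarO hX h₀ j) with h | h
        · exact h
        · exfalso
          rcases Nat.lt_or_ge j n₀ with hjn' | hjn'
          · have := Nat.le_findGreatest (P := fun c => 𝒯.IsClosedCell' SQ (𝒯.outCell d₀ c)) (n := n₀ - 1) (by omega) h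
            rw [← hc] at this
            omega
          · have : j = n₀ := le_antisymm hjn hjn'
            rw [this] at h
            exact (not_open_of_isClosedCell' hSQW hSQO hdisj h).1 hi'
      obtain ⟨t, q, htP, hcq⟩ : ∃ t q, t < period h₀ ∧ c = t + q * period h₀ :=
        ⟨c % period h₀, c / period h₀, Nat.mod_lt _ hP0, (Nat.mod_add_div' c _).symm⟩
      have htT : t ∈ 𝒯.transitions' d₀ SQ h₀ := by
        refine Finset.mem_filter.2 ⟨Finset.mem_range.2 htP, ?_, ?_⟩
        · rw [← hcl_per t q, ← hcq]; exact hccl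
        · rw [← hopen_per (t + 1) q, show t + 1 + q * period h₀ = c + 1 by rw [hcq]; ring]
          exact hopen_after (c + 1) (by omega) (by omega)
      obtain ⟨m, hmn⟩ : ∃ m, m + q * period h₀ = n₀ := ⟨n₀ - q * period h₀, by omega⟩
      have hm_hub : 𝒯.hubContact d₀ m := by rw [← hhub_per m q, hmn]; exact hi'
      have hm_att : v ∈ 𝒯.att (𝒯.outCell d₀ m) := by rw [← hout_per m q, hmn]; exact hv'
      have hm_open : ∀ j, t < j → j ≤ m → 𝒯.IsOpenSide d₀ j := by
        intro j h1 h2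
        rw [← hopen_per j q]
        exact hopen_after _ (by omega) (by omega)
      have hgood : good t := ⟨m, by omega, hm_hub, hm_open⟩
      refine ⟨rep t, Finset.mem_image.2 ⟨t, htT, rfl⟩, ?_⟩
      have hrep : rep t = (𝒯.att_nonempty (Nat.find_spec hgood).2.1).choose := by
        simp only [rep, dif_pos hgood]
      obtain ⟨htn₁, hn₁hub, hn₁open⟩ := Nat.find_spec hgood
      have hn₁m : Nat.find hgood ≤ m := Nat.find_min' hgood ⟨by omega, hm_hub, hm_open⟩
      have hw : rep t ∈ 𝒯.att (𝒯.outCell d₀ (Nat.find hgood)) := by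
        rw [hrep]; exact (𝒯.att_nonempty (Nat.find_spec hgood).2.1).choose_spec
      exact (hubConn_of_open_stretch' h₀ hT hfar hn₁m (fun l h1 h2 => hm_open l (by omega) h2) hn₁hub hm_hub hw hm_att).symm


end Owners

end TileData

end CellComplex

end Literature.Probability.Percolation

end
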